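import Mathlib.NumberTheory.LSeries.DirichletContinuation
import Mathlib.NumberTheory.DirichletCharacter.Basic
import Mathlib.NumberTheory.MulChar.Basic
import Mathlib.NumberTheory.LegendreSymbol.JacobiSymbol
import Mathlib.NumberTheory.Chebyshev
import Mathlib.Analysis.SpecialFunctions.Pow.Real
import HarnessLib

/-!
# Primes and the exceptional character in the presence of a Siegel zero: the Linnik-range
# explicit formula (Granville–Mollin 2000, (3.3)) and the sparsity of exceptional primes
# (Tao–Teräväinen 2022, Proposition 3.5)

Topic `Literature/NumberTheory/LFunctions`. Two named facts (D-0014: statements as printed, no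
`sorry`) describing the values `χ(p)` of the exceptional real character at primes when `L(s, χ)`
has a real zero `β = 1 − 1/(η log q)` of large quality `η`; they are the analytic inputs of
Granville–Mollin's Proposition 2 (`Literature.Barriers.Parity.GranvilleMollin2000_prop2`,
`Literature/Barriers/Parity/SiegelZeroQuadraticPolynomials.lean`), whose proof from them is
`Literature/Barriers/Parity/SiegelZeroQuadraticPolynomialsProofs.lean`.

* `jacobiTheta q x = θ(x; (·/q)) = ∑_{p ≤ x} (p/q) log p` — the prime sum of the Jacobi symbol
  (for square-free `q ≡ 3 (mod 4)` this is `∑_{p ≤ x} (d/p) log p` with `d = −q`, see below);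
* `GranvilleMollin2000_eq33` — **Granville–Mollin (3.3)**: for fixed `C > 9` and `x > |d|^C`,
  `∑_{p ≤ x} (d/p) log p + x^β/β ≪ x/(|d| log x) + x^{1 − c/log|d|}/η` when `L(s, (d/·))` has the
  Siegel zero `β`, `η = 1/((1 − β) log|d|)` (a Linnik-type explicit formula: Davenport §19 with
  Bombieri's log-free zero-density estimate and the Deuring–Heilbronn phenomenon);
* `TaoTeravainen2021_prop35` — **Tao–Teräväinen, Proposition 3.5 (first bound)**: for a Siegel
  zero of quality `η` attached to `χ` of conductor `q` and `ε > 0`,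
  `∑_{q^{(1+ε)/2} < p* ≤ x} 1/p* ≪_ε (log_q x)/η` over the exceptional primes `p*`
  (`χ(p*) ≠ −1`), for every `x ≥ q^{(1+ε)/2}`.

Both are specialised to the conductors that occur in Granville–Mollin's Theorem 4 /
Proposition 2 for `d ≡ 1 (mod 4)`: `d < 0` square-free with `d ≡ 1 (mod 4)`, i.e. `d = −q` with
`q ≡ 3 (mod 4)` square-free, for which the Kronecker symbol `(d/·)` is the Jacobi symbol
`(·/q)` and is THE primitive quadratic character mod `q` (design note 1).

## What the sources print (read at the cited pages)

* Granville–Mollin, *Rabinowitsch revisited*, Acta Arith. 96 (2000) 139–153, §3 (pp. 145–146):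
  "(3.1) [Davenport §19 (13)–(14)] for `x ≥ T ≥ |d| ≥ 1` where `d` is not a square,
  `∑_{p ≤ x} (d/p) log p + x^β/β ≪ x log²x/T + x^{1/2} + ∑_{|γ| < T} x^{Re ϱ}`, where the
  "`x^β/β`" occurs only if there is a Siegel zero `β` of `L(β, (d/·))`, and the sum is over all
  other zeros"; "(3.2) [Bombieri, *Le grand crible*, pp. 54–55] for fixed `C > 9`, there exists a
  small constant `c > 0` such that if `x ≥ T^C` then `∑_{|d| ≤ T} ∑_{|γ| < T} x^{Re ϱ} ≪
  x^{1/2} T³ + δ x^{1 − c/log T}`, where `δ = (1 − β) log T` if there is a Siegel zero, and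
  `δ = 1` otherwise"; "Fix `C > 9`. Inserting (3.2) into (3.1) with `T = |d| log³x` gives, for
  `x > |d|^C`, (3.3) `∑_{p ≤ x} (d/p) log p + x^β/β ≪ x/(|d| log x) + x^{1 − c/log|d|}/η`
  (after some calculations when `x > e^{|d|}`)." The Siegel zero and `η` are those of p. 142:
  "`L(σ + it, χ) ≠ 0` for `σ ≥ 1 − c/log(q(|t| + 2))` (for some explicit `c > 0`), except
  possibly when `χ` is real and `t = 0` … we shall denote this zero by `β` if it exists, and
  assume `η := 1/((1 − β) log q) ≥ 3`". §5 (p. 148, first display, `a = 1`): `ω(p) = 1 + (d/p)`.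
  [cite: GranvilleMollin2000, §3 (3.1)–(3.3) and p. 142]
* Tao–Teräväinen, *The Hardy–Littlewood–Chowla conjecture in the presence of a Siegel zero*,
  J. London Math. Soc. 106 (2022), arXiv:2109.06291. Definition 1.4: "A Siegel zero `β` is a
  real number associated to a primitive quadratic Dirichlet character `χ` of conductor `q_χ`
  such that `L(β, χ) = 0` and `β = 1 − 1/(η log q_χ)` for some `η ≥ 10` (which we call the
  quality of the zero)." §2: "We define an exceptional prime to be a prime `p*` such that
  `χ(p*) ≠ −1`; sums over `p*` … will always be understood to be over exceptional primes";
  "`X ≪ Y` … `|X| ≤ CY` where `C` is a constant which is allowed to depend on the "fixed"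
  quantities …; we permit the constants to be ineffective … `X ≪_A Y` denotes the bound
  `|X| ≤ C_A Y` where `C_A` depends on the parameter `A` as well"; "We will also assume that `η`
  is sufficiently large depending on the fixed quantities". **Proposition 3.5.** "Let `ε > 0`.
  Then for any `x ≥ q_χ^{(1+ε)/2}`, one has `∑_{q_χ^{(1+ε)/2} < p* ≤ x} 1/p* ≪_ε (log_{q_χ} x)/η`
  and for any natural number `m ≥ 2`, we have
  `∑_{q_χ^{(1+ε)/(2m)} < p* ≤ q_χ^{(1+ε)/(2(m−1))}} 1/p* ≪_ε m/η^{1/m}`." (Proof, p. 10–11: the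
  Montgomery–Vaughan asymptotic `∑_{n ≤ x} (1∗χ)(n)/n = (log x + γ)L(1, χ) + L'(1, χ) +
  O_ε(q_χ^{−ε/10})` for `x ≥ q_χ^{(1+ε)/2}`, Siegel's theorem, `(L'/L)(1, χ) ≍ η log q_χ`, and the
  non-negativity and multiplicativity of `1∗χ`.) §3.3 also reports Heath-Brown's
  `∑_{p* ≤ q_χ^{500}} log p*/p* ≪ log q_χ/√(log η)` (the bound quoted by Granville–Mollin, §5C).
  [cite: TaoTeravainen2021, Definition 1.4, §2 and Proposition 3.5]

## Design notes

1. The character. For `q` odd and square-free the primitive quadratic characters mod `q` are the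
   Kronecker symbols `(D/·)` with `|D| = q`, `D ≡ 1 (mod 4)` a quadratic discriminant — exactly
   one, `D = q` or `D = −q` as `q ≡ 1` or `3 (mod 4)` — and `(D/n) = (n/q)` (Jacobi) for `n ≥ 1`
   (Montgomery–Vaughan, Theorem 9.13 and its proof: `(p/n)_K = (n/p)_L` for `p ≡ 1 (mod 4)`,
   `(n/p)_L = χ_{−p}(n)` for `p ≡ 3 (mod 4)`, multiplicativity in `D`).
   [cite: MontgomeryVaughan2007, Theorem 9.13] So for `q ≡ 3 (mod 4)` square-free and `d = −q`
   the printed `(d/p)` is Mathlib's `jacobiSym p q`, "`χ(p*) ≠ −1`" is `jacobiSym p q ≠ -1`, and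
   "`L(s, (d/·))` has the real zero `β`" is rendered, as in the sibling Siegel-zero entries
   (`Literature.Barriers.Parity.IsSiegelZero`), by `∀ χ : DirichletCharacter ℂ q, χ.IsPrimitive →
   χ.IsQuadratic → χ.LFunction β = 0 → …` (a singleton class of `χ`). [folklore]
2. "The Siegel zero". In both sources `β` is the exceptional real zero relative to a zero-free
   region `σ ≥ 1 − c₀/log(q(|t|+2))`; a real zero `β = 1 − 1/(η log q)` with `η ≥ η₀ ≥ 2/c₀`
   lies in that region, hence IS the exceptional zero, with the printed `η`. The facts therefore
   carry a threshold `∃ η₀` (and a size threshold on `q`, under which finitely many conductors —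
   each with at most one exceptional zero — are dropped); both only weaken the printed claims.
3. `≪` with an unspecified (for Tao–Teräväinen possibly ineffective) constant is `∃ K`, placed
   after the parameters it may depend on (`C`, resp. `ε`) and before everything else.
4. `x^β/β` is written with Mathlib's real power `x ^ β / β`, `β = 1 − 1/(η log q)`; for
   `x > q^C ≥ 3^9`, `log x > 0`.
-/

noncomputable section

open Finset

namespace Literature.NumberTheory.LFunctions.SiegelZero

/-! ### The prime sum of the Jacobi symbol -/

/-- `θ(x; (·/q)) = ∑_{p ≤ x} (p/q) log p`, the Chebyshev `θ`-function twisted by the Jacobi symbol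
`(·/q)`; for `q ≡ 3 (mod 4)` square-free this is Granville–Mollin's `∑_{p ≤ x} (d/p) log p`,
`d = −q` (design note 1). [cite: GranvilleMollin2000, §3 (3.1)] -/
def jacobiTheta (q : ℕ) (x : ℝ) : ℝ :=
  ∑ p ∈ Nat.primesLE ⌊x⌋₊, ((jacobiSym (p : ℤ) q : ℤ) : ℝ) * Real.log (p : ℝ)

/-- `θ(x; (·/q))` depends only on `⌊x⌋`. [folklore] -/
theorem jacobiTheta_eq_floor (q : ℕ) (x : ℝ) : jacobiTheta q x = jacobiTheta q (⌊x⌋₊ : ℝ) := by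
  simp [jacobiTheta]

/-- `|(a/b)| ≤ 1` for the Jacobi symbol, as a real number. [folklore] -/
theorem abs_jacobiSym_cast_le_one (a : ℤ) (b : ℕ) : |((jacobiSym a b : ℤ) : ℝ)| ≤ 1 := by
  rcases jacobiSym.trichotomy a b with h | h | h <;> simp [h]

/-- `|θ(x; (·/q))| ≤ θ(x)` (Mathlib's `Chebyshev.theta`). [folklore] -/
theorem abs_jacobiTheta_le_theta (q : ℕ) (x : ℝ) : |jacobiTheta q x| ≤ Chebyshev.theta x := by
  rw [jacobiTheta, Chebyshev.theta_eq_sum_primesLE]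
  refine (abs_sum_le_sum_abs _ _).trans (sum_le_sum fun p hp => ?_)
  have hp1 : (1 : ℝ) ≤ p := by exact_mod_cast (Nat.prime_of_mem_primesLE hp).one_lt.le
  rw [abs_mul, abs_of_nonneg (Real.log_nonneg hp1)]
  exact (mul_le_mul_of_nonneg_right (abs_jacobiSym_cast_le_one _ _) (Real.log_nonneg hp1)).trans
    (by rw [one_mul])

/-! ### Granville–Mollin (3.3): the explicit formula in the Linnik range -/

/-- **Granville–Mollin 2000, (3.3)** (specialised to negative square-free `d ≡ 1 (mod 4)`, i.e.
`d = −q`, `q ≡ 3 (mod 4)` square-free, where `(d/p) = (p/q)` and `L(s, (d/·))` is the `L`-function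
of the primitive quadratic character mod `q`; design notes 1–4): "Fix `C > 9`. … for `x > |d|^C`,
`∑_{p ≤ x} (d/p) log p + x^β/β ≪ x/(|d| log x) + x^{1 − c/log|d|}/η`", `c > 0` a small constant
depending on `C`, `β` the Siegel zero of `L(s, (d/·))` and `η = 1/((1 − β) log|d|)`. Rendered: for
every `C > 9` there are `c > 0`, `K`, `η₀`, `q₀` such that for all square-free `q ≡ 3 (mod 4)` with
`q ≥ q₀`, every primitive quadratic `χ` mod `q`, every `η ≥ η₀` with `L(1 − 1/(η log q), χ) = 0`
and every `x > q^C`: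
`|θ(x; (·/q)) + x^β/β| ≤ K (x/(q log x) + x^{1 − c/log q}/η)`, `β = 1 − 1/(η log q)`.
[cite: GranvilleMollin2000, §3 (3.3)] -/
def GranvilleMollin2000_eq33 : Prop :=
  ∀ C : ℝ, 9 < C → ∃ c : ℝ, 0 < c ∧ ∃ K η₀ q₀ : ℝ, ∀ (q : ℕ) [NeZero q], Squarefree q →
    q % 4 = 3 → q₀ ≤ (q : ℝ) → ∀ χ : DirichletCharacter ℂ q, χ.IsPrimitive → χ.IsQuadratic →
      ∀ η : ℝ, η₀ ≤ η → χ.LFunction ((1 - 1 / (η * Real.log q) : ℝ) : ℂ) = 0 →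
        ∀ x : ℝ, (q : ℝ) ^ C < x →
          |jacobiTheta q x +
              x ^ (1 - 1 / (η * Real.log q)) / (1 - 1 / (η * Real.log q))| ≤
            K * (x / (q * Real.log x) + x ^ (1 - c / Real.log q) / η)

/-! ### Tao–Teräväinen, Proposition 3.5: exceptional primes are sparse -/

/-- **Tao–Teräväinen 2022, Proposition 3.5, first bound** (specialised to conductors
`q ≡ 3 (mod 4)` square-free, where the primitive quadratic character is `(·/q)` and a prime `p*`
is exceptional iff `(p*/q) ≠ −1`; design notes 1–3): for a Siegel zero `β = 1 − 1/(η log q)` of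
quality `η` (Definition 1.4) and `ε > 0`, "for any `x ≥ q^{(1+ε)/2}`, one has
`∑_{q^{(1+ε)/2} < p* ≤ x} 1/p* ≪_ε (log_q x)/η`", the constant depending on `ε` (possibly
ineffectively), `η` sufficiently large. Rendered: for every `ε > 0` there are `K`, `η₀`, `q₀` such
that for all square-free `q ≡ 3 (mod 4)` with `q ≥ q₀`, every primitive quadratic `χ` mod `q`,
every `η ≥ η₀` with `L(1 − 1/(η log q), χ) = 0` and every `x ≥ q^{(1+ε)/2}`:
`∑_{q^{(1+ε)/2} < p ≤ x, (p/q) ≠ −1} 1/p ≤ K (log x / log q)/η`.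
[cite: TaoTeravainen2021, Proposition 3.5] -/
def TaoTeravainen2021_prop35 : Prop :=
  ∀ ε : ℝ, 0 < ε → ∃ K η₀ q₀ : ℝ, ∀ (q : ℕ) [NeZero q], Squarefree q → q % 4 = 3 →
    q₀ ≤ (q : ℝ) → ∀ χ : DirichletCharacter ℂ q, χ.IsPrimitive → χ.IsQuadratic →
      ∀ η : ℝ, η₀ ≤ η → χ.LFunction ((1 - 1 / (η * Real.log q) : ℝ) : ℂ) = 0 →
        ∀ x : ℝ, (q : ℝ) ^ ((1 + ε) / 2) ≤ x →
          ∑ p ∈ (Nat.primesLE ⌊x⌋₊).filter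
              (fun p : ℕ => (q : ℝ) ^ ((1 + ε) / 2) < (p : ℝ) ∧ jacobiSym (p : ℤ) q ≠ -1), (1 : ℝ) / (p : ℝ) ≤
            K * (Real.log x / Real.log q) / η

end Literature.NumberTheory.LFunctions.SiegelZero
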